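import Mathlib
import HarnessLib
import Summits.HubbardSuperconductivity.HubbardSuperconductivity.Theorems.KLProgrammeH10TwoPointLimitTorusPlancherelDifferences

/-!
# Route `KLProgramme` — engine support: the `ℓ²` route on the PRODUCT (space-time) torus `(ℤ/Pℤ)^{d₁} × (ℤ/Lℤ)^{d₂}` —
# Plancherel for product character sums, Plancherel with differences in EITHER factor, and the `ℓ¹` step

Layer (a) of HOME/prover-p4/FRAME-L22-NOTE.md §3′ (route (L2′)).  The finite-volume sector kernels of the Hubbard torus are product-torus character
sums `g(z₁, z₂) = Σ_{(p₁,p₂)} χ_{p₁}(z₁) χ_{p₂}(z₂) Φ(p₁, p₂)` over the time dual torus `(ℤ/2Mℤ)¹` and the momentum torus `(ℤ/Lℤ)²`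
(`HubbardSpaceTimeCharacters.norm_sum_conj_hubbardPlaneWave_mul_eq`).  Iterating the single-torus layer
(`KLProgrammeH10TwoPointLimitTorusPlancherelDifferences.lean`):

* **`sum_norm_sq_prodCharSum`** — `Σ_{(z₁,z₂)} ‖g(z₁,z₂)‖² = P^{d₁} L^{d₂} Σ_{(p₁,p₂)} ‖Φ(p₁,p₂)‖²`;
* `prodCharSum_foldr_fwdDiff_fst/snd` — differences of `Φ` in the first (resp. second) variable multiply `g` by `Π (conj χ_v(z₁) − 1)^N`
  (resp. `z₂`);
* **`sum_prod_norm_sub_one_pow_mul_norm_sq_prodCharSum`** — Plancherel with mixed differences in both factors: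
  `Σ_z (Π_i ‖χ_{u_i}(z₁) − 1‖^{M_i} Π_j ‖χ_{v_j}(z₂) − 1‖^{N_j})² ‖g(z)‖² = P^{d₁} L^{d₂} Σ_p ‖(Δ¹_{u}^{M} Δ²_{v}^{N} Φ)(p)‖²`;
* **`sum_norm_prodCharSum_le_of_differences`** — the `ℓ¹` step with a linear (expanded product) weight.

Everything is proved; no definitions, no named facts. [folklore]
-/

noncomputable section

namespace Summit.HubbardSuperconductivity.HubbardSuperconductivity.Theorems.TorusFourierL2

set_option linter.dupNamespace false -- summit = problem name (single-conjunct summit), D-0017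

open Finset Complex Literature.Probability.LatticeModels
open scoped Real ComplexConjugate

variable {d₁ d₂ P L : ℕ} [NeZero P] [NeZero L]

/-! ### Plancherel on the product torus -/

/-- The product character sum, summed over the second factor first: `g(z₁,z₂) = Σ_{p₂} χ_{p₂}(z₂) (Σ_{p₁} χ_{p₁}(z₁) Φ(p₁,p₂))`. [folklore] -/
theorem prodCharSum_eq_iterated (Φ : TorusSite d₁ P × TorusSite d₂ L → ℂ) (z₁ : TorusSite d₁ P) (z₂ : TorusSite d₂ L) :
    ∑ p : TorusSite d₁ P × TorusSite d₂ L, torusChar p.1 z₁ * torusChar p.2 z₂ * Φ p =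
      ∑ p₂, torusChar p₂ z₂ * ∑ p₁, torusChar p₁ z₁ * Φ (p₁, p₂) := by
  rw [Fintype.sum_prod_type, Finset.sum_comm]
  refine Finset.sum_congr rfl fun p₂ _ => ?_
  rw [Finset.mul_sum]
  refine Finset.sum_congr rfl fun p₁ _ => ?_
  ring

/-- **Plancherel for product character sums**: `Σ_{(z₁,z₂)} ‖Σ_p χ_{p₁}(z₁)χ_{p₂}(z₂) Φ(p)‖² = P^{d₁} L^{d₂} Σ_p ‖Φ(p)‖²`. [folklore] -/
theorem sum_norm_sq_prodCharSum (Φ : TorusSite d₁ P × TorusSite d₂ L → ℂ) :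
    ∑ z : TorusSite d₁ P × TorusSite d₂ L, ‖∑ p : TorusSite d₁ P × TorusSite d₂ L, torusChar p.1 z.1 * torusChar p.2 z.2 * Φ p‖ ^ 2 =
      (P : ℝ) ^ d₁ * (L : ℝ) ^ d₂ * ∑ p : TorusSite d₁ P × TorusSite d₂ L, ‖Φ p‖ ^ 2 := by
  rw [Fintype.sum_prod_type]
  simp_rw [prodCharSum_eq_iterated]
  -- Plancherel in the second factor, for each `z₁`
  have h2 : ∀ z₁ : TorusSite d₁ P, ∑ z₂ : TorusSite d₂ L, ‖∑ p₂, torusChar p₂ z₂ * ∑ p₁, torusChar p₁ z₁ * Φ (p₁, p₂)‖ ^ 2 =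
      (L : ℝ) ^ d₂ * ∑ p₂, ‖∑ p₁, torusChar p₁ z₁ * Φ (p₁, p₂)‖ ^ 2 := fun z₁ =>
    sum_norm_sq_charSum (fun p₂ => ∑ p₁, torusChar p₁ z₁ * Φ (p₁, p₂))
  simp_rw [h2]
  rw [← Finset.mul_sum, Finset.sum_comm]
  -- Plancherel in the first factor, for each `p₂`
  have h1 : ∀ p₂ : TorusSite d₂ L, ∑ z₁ : TorusSite d₁ P, ‖∑ p₁, torusChar p₁ z₁ * Φ (p₁, p₂)‖ ^ 2 =
      (P : ℝ) ^ d₁ * ∑ p₁, ‖Φ (p₁, p₂)‖ ^ 2 := fun p₂ => sum_norm_sq_charSum (fun p₁ => Φ (p₁, p₂))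
  simp_rw [h1]
  rw [← Finset.mul_sum, Fintype.sum_prod_type, Finset.sum_comm]
  ring

/-! ### Differences in either factor -/

/-- Differences in the FIRST variable: `Σ_p χχ (Δ¹_{u}-iterate Φ)(p) = Π (conj χ_u(z₁) − 1)^M · g(z)`. [folklore] -/
theorem prodCharSum_foldr_fwdDiff_fst (l : List (TorusSite d₁ P × ℕ)) (Φ : TorusSite d₁ P × TorusSite d₂ L → ℂ)
    (z₁ : TorusSite d₁ P) (z₂ : TorusSite d₂ L) :
    ∑ p : TorusSite d₁ P × TorusSite d₂ L, torusChar p.1 z₁ * torusChar p.2 z₂ *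
        (l.foldr (fun q G => (fwdDiff (q.1, (0 : TorusSite d₂ L)))^[q.2] G) Φ) p =
      (l.map fun q => (conj (torusChar q.1 z₁) - 1) ^ q.2).prod *
        ∑ p : TorusSite d₁ P × TorusSite d₂ L, torusChar p.1 z₁ * torusChar p.2 z₂ * Φ p := by
  -- differences with step `(u, 0)` act on the first variable only
  have hstep : ∀ (u : TorusSite d₁ P) (N : ℕ) (G : TorusSite d₁ P × TorusSite d₂ L → ℂ) (p₂ : TorusSite d₂ L),
      (fun p₁ => ((fwdDiff (u, (0 : TorusSite d₂ L)))^[N] G) (p₁, p₂)) = (fwdDiff u)^[N] (fun q₁ => G (q₁, p₂)) := by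
    intro u N
    induction N with
    | zero => intro G p₂; rfl
    | succ N ih =>
      intro G p₂
      funext p₁
      rw [Function.iterate_succ_apply', Function.iterate_succ_apply', ← ih G p₂]
      simp only [fwdDiff, Prod.mk_add_mk, add_zero]
  have hfold : ∀ (p₂ : TorusSite d₂ L),
      (fun p₁ => (l.foldr (fun q G => (fwdDiff (q.1, (0 : TorusSite d₂ L)))^[q.2] G) Φ) (p₁, p₂)) =
        l.foldr (fun q g => (fwdDiff q.1)^[q.2] g) (fun q₁ => Φ (q₁, p₂)) := by
    induction l with
    | nil => intro p₂; rfl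
    | cons q l ih =>
      intro p₂
      rw [List.foldr_cons, List.foldr_cons, hstep, ih p₂]
  rw [prodCharSum_eq_iterated, prodCharSum_eq_iterated, Finset.mul_sum]
  refine Finset.sum_congr rfl fun p₂ _ => ?_
  have : ∑ p₁, torusChar p₁ z₁ * (l.foldr (fun q G => (fwdDiff (q.1, (0 : TorusSite d₂ L)))^[q.2] G) Φ) (p₁, p₂) =
      ∑ p₁, torusChar p₁ z₁ * (l.foldr (fun q g => (fwdDiff q.1)^[q.2] g) (fun q₁ => Φ (q₁, p₂))) p₁ :=
    Finset.sum_congr rfl fun p₁ _ => by rw [← hfold p₂]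
  rw [this, charSum_foldr_fwdDiff]
  ring

/-- Differences in the SECOND variable: `Σ_p χχ (Δ²_{v}-iterate Φ)(p) = Π (conj χ_v(z₂) − 1)^N · g(z)`. [folklore] -/
theorem prodCharSum_foldr_fwdDiff_snd (l : List (TorusSite d₂ L × ℕ)) (Φ : TorusSite d₁ P × TorusSite d₂ L → ℂ)
    (z₁ : TorusSite d₁ P) (z₂ : TorusSite d₂ L) :
    ∑ p : TorusSite d₁ P × TorusSite d₂ L, torusChar p.1 z₁ * torusChar p.2 z₂ *
        (l.foldr (fun q G => (fwdDiff ((0 : TorusSite d₁ P), q.1))^[q.2] G) Φ) p =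
      (l.map fun q => (conj (torusChar q.1 z₂) - 1) ^ q.2).prod *
        ∑ p : TorusSite d₁ P × TorusSite d₂ L, torusChar p.1 z₁ * torusChar p.2 z₂ * Φ p := by
  have hstep : ∀ (v : TorusSite d₂ L) (N : ℕ) (G : TorusSite d₁ P × TorusSite d₂ L → ℂ) (p₁ : TorusSite d₁ P),
      (fun p₂ => ((fwdDiff ((0 : TorusSite d₁ P), v))^[N] G) (p₁, p₂)) = (fwdDiff v)^[N] (fun q₂ => G (p₁, q₂)) := by
    intro v N
    induction N with
    | zero => intro G p₁; rfl
    | succ N ih =>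
      intro G p₁
      funext p₂
      rw [Function.iterate_succ_apply', Function.iterate_succ_apply', ← ih G p₁]
      simp only [fwdDiff, Prod.mk_add_mk, add_zero]
  have hfold : ∀ (p₁ : TorusSite d₁ P),
      (fun p₂ => (l.foldr (fun q G => (fwdDiff ((0 : TorusSite d₁ P), q.1))^[q.2] G) Φ) (p₁, p₂)) =
        l.foldr (fun q g => (fwdDiff q.1)^[q.2] g) (fun q₂ => Φ (p₁, q₂)) := by
    induction l with
    | nil => intro p₁; rfl
    | cons q l ih =>
      intro p₁
      rw [List.foldr_cons, List.foldr_cons, hstep, ih p₁]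
  -- sum over the first factor first
  have hiter : ∀ (G : TorusSite d₁ P × TorusSite d₂ L → ℂ),
      ∑ p : TorusSite d₁ P × TorusSite d₂ L, torusChar p.1 z₁ * torusChar p.2 z₂ * G p =
        ∑ p₁, torusChar p₁ z₁ * ∑ p₂, torusChar p₂ z₂ * G (p₁, p₂) := by
    intro G
    rw [Fintype.sum_prod_type]
    refine Finset.sum_congr rfl fun p₁ _ => ?_
    rw [Finset.mul_sum]
    refine Finset.sum_congr rfl fun p₂ _ => ?_
    ring
  rw [hiter, hiter, Finset.mul_sum]
  refine Finset.sum_congr rfl fun p₁ _ => ?_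
  have : ∑ p₂, torusChar p₂ z₂ * (l.foldr (fun q G => (fwdDiff ((0 : TorusSite d₁ P), q.1))^[q.2] G) Φ) (p₁, p₂) =
      ∑ p₂, torusChar p₂ z₂ * (l.foldr (fun q g => (fwdDiff q.1)^[q.2] g) (fun q₂ => Φ (p₁, q₂))) p₂ :=
    Finset.sum_congr rfl fun p₂ _ => by rw [← hfold p₁]
  rw [this, charSum_foldr_fwdDiff]
  ring

/-- **Plancherel with mixed differences in both factors**:
`Σ_z (Π_i ‖χ_{u_i}(z₁) − 1‖^{M_i})² (Π_j ‖χ_{v_j}(z₂) − 1‖^{N_j})² ‖g(z)‖² = P^{d₁} L^{d₂} Σ_p ‖(Δ¹_u^M (Δ²_v^N Φ))(p)‖²`. [folklore] -/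
theorem sum_prod_norm_sub_one_pow_mul_norm_sq_prodCharSum (l₁ : List (TorusSite d₁ P × ℕ)) (l₂ : List (TorusSite d₂ L × ℕ))
    (Φ : TorusSite d₁ P × TorusSite d₂ L → ℂ) :
    ∑ z : TorusSite d₁ P × TorusSite d₂ L,
        (l₁.map fun q => ‖torusChar q.1 z.1 - 1‖ ^ q.2).prod ^ 2 * (l₂.map fun q => ‖torusChar q.1 z.2 - 1‖ ^ q.2).prod ^ 2 *
          ‖∑ p : TorusSite d₁ P × TorusSite d₂ L, torusChar p.1 z.1 * torusChar p.2 z.2 * Φ p‖ ^ 2 =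
      (P : ℝ) ^ d₁ * (L : ℝ) ^ d₂ *
        ∑ p : TorusSite d₁ P × TorusSite d₂ L,
          ‖(l₁.foldr (fun q G => (fwdDiff (q.1, (0 : TorusSite d₂ L)))^[q.2] G)
              (l₂.foldr (fun q G => (fwdDiff ((0 : TorusSite d₁ P), q.1))^[q.2] G) Φ)) p‖ ^ 2 := by
  rw [← sum_norm_sq_prodCharSum]
  refine Finset.sum_congr rfl fun z _ => ?_
  rw [prodCharSum_foldr_fwdDiff_fst, prodCharSum_foldr_fwdDiff_snd, norm_mul, norm_mul,
    norm_prod_conj_torusChar_sub_one_pow, norm_prod_conj_torusChar_sub_one_pow]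
  ring

/-- **Linear (expanded product) weights on the product torus**: for terms `t ∈ T` with coefficient `c t`, time part `l₁ t` and space
part `l₂ t`: `Σ_z W(z) ‖g(z)‖² = P^{d₁}L^{d₂} Σ_t c_t Σ_p ‖Δ_t Φ(p)‖²`,
`W(z) = Σ_t c_t (Π‖χ_u(z₁) − 1‖^M)² (Π‖χ_v(z₂) − 1‖^N)²`. [folklore] -/
theorem sum_weight_mul_norm_sq_prodCharSum {ι : Type*} (T : Finset ι) (l₁ : ι → List (TorusSite d₁ P × ℕ))
    (l₂ : ι → List (TorusSite d₂ L × ℕ)) (c : ι → ℝ) (Φ : TorusSite d₁ P × TorusSite d₂ L → ℂ) :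
    ∑ z : TorusSite d₁ P × TorusSite d₂ L,
        (∑ t ∈ T, c t * (((l₁ t).map fun q => ‖torusChar q.1 z.1 - 1‖ ^ q.2).prod ^ 2 *
          ((l₂ t).map fun q => ‖torusChar q.1 z.2 - 1‖ ^ q.2).prod ^ 2)) *
          ‖∑ p : TorusSite d₁ P × TorusSite d₂ L, torusChar p.1 z.1 * torusChar p.2 z.2 * Φ p‖ ^ 2 =
      (P : ℝ) ^ d₁ * (L : ℝ) ^ d₂ * ∑ t ∈ T, c t *
        ∑ p : TorusSite d₁ P × TorusSite d₂ L,
          ‖((l₁ t).foldr (fun q G => (fwdDiff (q.1, (0 : TorusSite d₂ L)))^[q.2] G)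
              ((l₂ t).foldr (fun q G => (fwdDiff ((0 : TorusSite d₁ P), q.1))^[q.2] G) Φ)) p‖ ^ 2 := by
  have h1 : ∀ z : TorusSite d₁ P × TorusSite d₂ L,
      (∑ t ∈ T, c t * (((l₁ t).map fun q => ‖torusChar q.1 z.1 - 1‖ ^ q.2).prod ^ 2 *
          ((l₂ t).map fun q => ‖torusChar q.1 z.2 - 1‖ ^ q.2).prod ^ 2)) *
          ‖∑ p : TorusSite d₁ P × TorusSite d₂ L, torusChar p.1 z.1 * torusChar p.2 z.2 * Φ p‖ ^ 2 =
      ∑ t ∈ T, c t * ((((l₁ t).map fun q => ‖torusChar q.1 z.1 - 1‖ ^ q.2).prod ^ 2 *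
          ((l₂ t).map fun q => ‖torusChar q.1 z.2 - 1‖ ^ q.2).prod ^ 2) *
          ‖∑ p : TorusSite d₁ P × TorusSite d₂ L, torusChar p.1 z.1 * torusChar p.2 z.2 * Φ p‖ ^ 2) := by
    intro z
    rw [Finset.sum_mul]
    exact Finset.sum_congr rfl fun t _ => by ring
  rw [Finset.sum_congr rfl fun z _ => h1 z, Finset.sum_comm, Finset.mul_sum]
  refine Finset.sum_congr rfl fun t _ => ?_
  rw [← Finset.mul_sum, sum_prod_norm_sub_one_pow_mul_norm_sq_prodCharSum (l₁ t) (l₂ t) Φ]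
  ring

/-- **The `ℓ¹` norm of a product character sum from weighted differences of its symbol**:
`Σ_z ‖g(z)‖ ≤ √(P^{d₁}L^{d₂} Σ_t c_t Σ_p ‖Δ_t Φ(p)‖²) · √(Σ_z W(z)⁻¹)` for `W > 0`. [folklore] -/
theorem sum_norm_prodCharSum_le_of_differences {ι : Type*} (T : Finset ι) (l₁ : ι → List (TorusSite d₁ P × ℕ))
    (l₂ : ι → List (TorusSite d₂ L × ℕ)) (c : ι → ℝ) (Φ : TorusSite d₁ P × TorusSite d₂ L → ℂ)
    (hW : ∀ z : TorusSite d₁ P × TorusSite d₂ L, 0 < ∑ t ∈ T, c t *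
      (((l₁ t).map fun q => ‖torusChar q.1 z.1 - 1‖ ^ q.2).prod ^ 2 * ((l₂ t).map fun q => ‖torusChar q.1 z.2 - 1‖ ^ q.2).prod ^ 2)) :
    ∑ z : TorusSite d₁ P × TorusSite d₂ L, ‖∑ p : TorusSite d₁ P × TorusSite d₂ L, torusChar p.1 z.1 * torusChar p.2 z.2 * Φ p‖ ≤
      Real.sqrt ((P : ℝ) ^ d₁ * (L : ℝ) ^ d₂ * ∑ t ∈ T, c t *
        ∑ p : TorusSite d₁ P × TorusSite d₂ L,
          ‖((l₁ t).foldr (fun q G => (fwdDiff (q.1, (0 : TorusSite d₂ L)))^[q.2] G)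
              ((l₂ t).foldr (fun q G => (fwdDiff ((0 : TorusSite d₁ P), q.1))^[q.2] G) Φ)) p‖ ^ 2) *
      Real.sqrt (∑ z : TorusSite d₁ P × TorusSite d₂ L, (∑ t ∈ T, c t *
        (((l₁ t).map fun q => ‖torusChar q.1 z.1 - 1‖ ^ q.2).prod ^ 2 *
          ((l₂ t).map fun q => ‖torusChar q.1 z.2 - 1‖ ^ q.2).prod ^ 2))⁻¹) := by
  have h := sum_norm_le_sqrt_mul_sqrt_of_weight Finset.univ
    (fun z : TorusSite d₁ P × TorusSite d₂ L => ∑ t ∈ T, c t *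
      (((l₁ t).map fun q => ‖torusChar q.1 z.1 - 1‖ ^ q.2).prod ^ 2 * ((l₂ t).map fun q => ‖torusChar q.1 z.2 - 1‖ ^ q.2).prod ^ 2))
    (fun z _ => hW z) (fun z => ∑ p : TorusSite d₁ P × TorusSite d₂ L, torusChar p.1 z.1 * torusChar p.2 z.2 * Φ p)
  rwa [sum_weight_mul_norm_sq_prodCharSum] at h

end Summit.HubbardSuperconductivity.HubbardSuperconductivity.Theorems.TorusFourierL2

end
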